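import Summits.CriticalPhenomena.SAWScalingLimit.Theses.SAWWeldingIdentification
import Summits.CriticalPhenomena.SAWScalingLimit.Theses.SAWLoopFugacityFlow
import HarnessLib

/-!
# Stub S1 `stub_simpleChordLimit` of crux `RemovableLimit` (stmt-CriticalPhenomena-4503) IS the
# sibling crux `SimpleSubseqLimits` (stmt-CriticalPhenomena-4982) — kernel-checked equivalence

Route `SAWWeldingIdentification`, crux `RemovableLimit`, line `birth`, stub S1: every subsequential
weak limit `P` of the critical `δℤ²` SAW laws of `(Q.carrier; a_δ, b_δ)` for a conformal rectangle
`Q` (Dobrushin domain `Q.chord 0 2 = (Q.carrier; Q.pt 0, Q.pt 2)`) is carried by SIMPLE CHORDS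
(simple, from `Q.pt 0` to `Q.pt 2`, inside `closure Q.carrier`, meeting `frontier Q.carrier` only
at the two marked points).

This file proves, with no `sorry`, that the stub statement S1 (verbatim, as registered; it is
inlined in every theorem below, never abbreviated) is EQUIVALENT to the sibling route item
`Summit.CriticalPhenomena.SAWScalingLimit.Theses.SAWLoopFugacityFlow.SimpleSubseqLimits`
(stmt-CriticalPhenomena-4982, terminal verdict `open-problem` after nine lead seats — its residual
is the research-open `δ`-uniform first-entrance slit-avoidance estimate `PastFutureAvoidance` for
the critical `ℤ²` SAW, see `Cruxes/SimpleSubseqLimits/NOTES.md` §0, §9):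

* `stub_of_simpleSubseqLimits : SimpleSubseqLimits → S1` — specialise the Dobrushin domain to
  `Q.chord 0 2` (same carrier; marked points `Q.pt 0`, `Q.pt 2` by `rfl`) and note that
  `(∀ n, 0 < δ_n) ∧ δ_n → 0` is `δ_n → 0⁺` (`tendsto_nhdsWithin_iff`).
* `simpleSubseqLimits_of_stub : S1 → SimpleSubseqLimits` — every Dobrushin domain `D` is
  `Q.chord 0 2` for a conformal rectangle `Q` (`exists_chord_eq`: insert one mark in each open
  boundary arc, exactly Step 0 of the route's deciding theorem `closes`), and a sequence with
  `s → 0⁺` is positive from some index `N` on; the SHIFTED sequence `n ↦ s (n + N)` is positive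
  everywhere, still tends to `0`, and the weak-limit hypothesis survives the shift
  (`Tendsto.comp … (tendsto_add_atTop_nat N)`), while the conclusion does not mention the sequence.
* `simpleChordLimit_iff_simpleSubseqLimits : S1 ↔ SimpleSubseqLimits`.

Consequently S1 is exactly as hard as stmt-4982 (`open-problem`): no independent proof of S1
exists in the tree, and every loophole audit of stmt-4982 (degenerate endpoint approximations,
junk laws, non-closedness of `CurveClass.simple`, mesh-graph edges inside `closure Ω`; see
`Cruxes/SimpleSubseqLimits/Disproof.lean`) transfers verbatim to S1 through this equivalence.

References: [LawlerSchrammWerner2004SAW] §3.4.2; [KennedyLawler2013]; [DuminilCopinHammond2013].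
-/

open MeasureTheory Filter Set
open scoped Topology NNReal
open Literature.Probability.RandomPlanarGeometry Literature.Probability.LatticeModels

namespace Summit.CriticalPhenomena.SAWScalingLimit.Theorems.RemovableLimit

/-- **Every Dobrushin domain is the `0–2` chord of a conformal rectangle**: insert one auxiliary
mark in each of the two open boundary arcs (parameters `(m₀ + m₁)/2` and `(m₁ + 1)/2`). This is
Step 0 of the route's deciding theorem `SAWWeldingIdentification.closes`. [folklore] -/
theorem exists_chord_eq (D : DobrushinDomain) :
    ∃ Q : ConformalRectangle, Q.chord 0 2 (by decide) = D := by
  -- adapted from `Summit.CriticalPhenomena.SAWScalingLimit.Theses.SAWWeldingIdentification.closes`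
  -- (Step 0), Theses/SAWWeldingIdentification.lean
  obtain ⟨J, m, hm, hmem⟩ := D
  have h01 : m 0 < m 1 := hm (show (0 : Fin 2) < 1 by decide)
  have h0 : 0 ≤ m 0 ∧ m 0 < 1 := hmem 0
  have h1 : 0 ≤ m 1 ∧ m 1 < 1 := hmem 1
  refine ⟨⟨J, ![m 0, (m 0 + m 1) / 2, m 1, (m 1 + 1) / 2], ?_, ?_⟩, ?_⟩
  · refine Fin.strictMono_iff_lt_succ.2 fun k => ?_
    fin_cases k
    · show m 0 < (m 0 + m 1) / 2
      linarith
    · show (m 0 + m 1) / 2 < m 1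
      linarith
    · show m 1 < (m 1 + 1) / 2
      linarith
  · intro k
    fin_cases k
    · show m 0 ∈ Set.Ico (0 : ℝ) 1
      exact hmem 0
    · show (m 0 + m 1) / 2 ∈ Set.Ico (0 : ℝ) 1
      exact ⟨by linarith, by linarith⟩
    · show m 1 ∈ Set.Ico (0 : ℝ) 1
      exact hmem 1
    · show (m 1 + 1) / 2 ∈ Set.Ico (0 : ℝ) 1
      exact ⟨by linarith, by linarith⟩
  · simp only [MarkedDomain.chord]
    congr 1
    funext k
    fin_cases k <;> rfl

/-- **`SimpleSubseqLimits → S1`** (stmt-CriticalPhenomena-4982 discharges the stub): specialise the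
Dobrushin domain to `Q.chord 0 2` (carrier `Q.carrier`, marked points `Q.pt 0`, `Q.pt 2`, all by
`rfl`); `(∀ n, 0 < δ_n)` together with `δ_n → 0` is `δ_n → 0⁺`. The conclusion is the registered
text of `stub_simpleChordLimit`, verbatim. [folklore] -/
theorem stub_of_simpleSubseqLimits
    (h : Summit.CriticalPhenomena.SAWScalingLimit.Theses.SAWLoopFugacityFlow.SimpleSubseqLimits) :
    ∀ (Q : ConformalRectangle) (a b : ℝ → Site 2), SAW.IsEndpointApprox (Q.chord 0 2 (by decide)) a b →
    ∀ (P : Measure (CurveClass ℂ)), IsProbabilityMeasure P → ∀ (δs : ℕ → ℝ), (∀ n, 0 < δs n) →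
    Tendsto δs atTop (𝓝 0) →
    (∀ f : BoundedContinuousFunction (CurveClass ℂ) ℝ,
      Tendsto (fun n => ∫ γ, f γ.curve ∂(SAW.law Q.carrier (δs n) (a (δs n)) (b (δs n)))) atTop
        (𝓝 (∫ γ, f γ ∂P))) →
    ∀ᵐ γ ∂P, γ ∈ CurveClass.simple ∧ γ.source = Q.pt 0 ∧ γ.target = Q.pt 2 ∧
      γ.range ⊆ closure Q.carrier ∧ γ.range ∩ frontier Q.carrier ⊆ {Q.pt 0, Q.pt 2} := by
  -- adapted from `simpleChordLimit_of_simpleSubseqLimits`, Cruxes/RemovableLimit/Lines/birth.lean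
  intro Q a b hab P hP δs hpos hδ hlim
  have hδ' : Tendsto δs atTop (𝓝[>] (0 : ℝ)) :=
    tendsto_nhdsWithin_iff.2 ⟨hδ, Eventually.of_forall hpos⟩
  exact h (Q.chord 0 2 (by decide)) a b hab δs P hδ' hP hlim

/-- **`S1 → SimpleSubseqLimits`** (the stub discharges stmt-CriticalPhenomena-4982): write the
Dobrushin domain as `Q.chord 0 2` (`exists_chord_eq`); a sequence `s → 0⁺` is positive from some
index `N` on (`tendsto_nhdsWithin_iff`, `eventually_atTop`), so the shifted sequence
`n ↦ s (n + N)` is positive, tends to `0`, and the critical SAW laws along it still converge weakly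
to `ν` (`tendsto_add_atTop_nat`); the a.e. conclusion does not mention the sequence. The
hypothesis is the registered text of `stub_simpleChordLimit`, verbatim. [folklore] -/
theorem simpleSubseqLimits_of_stub
    (h : ∀ (Q : ConformalRectangle) (a b : ℝ → Site 2),
      SAW.IsEndpointApprox (Q.chord 0 2 (by decide)) a b →
      ∀ (P : Measure (CurveClass ℂ)), IsProbabilityMeasure P → ∀ (δs : ℕ → ℝ), (∀ n, 0 < δs n) →
      Tendsto δs atTop (𝓝 0) →
      (∀ f : BoundedContinuousFunction (CurveClass ℂ) ℝ,
        Tendsto (fun n => ∫ γ, f γ.curve ∂(SAW.law Q.carrier (δs n) (a (δs n)) (b (δs n)))) atTop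
          (𝓝 (∫ γ, f γ ∂P))) →
      ∀ᵐ γ ∂P, γ ∈ CurveClass.simple ∧ γ.source = Q.pt 0 ∧ γ.target = Q.pt 2 ∧
        γ.range ⊆ closure Q.carrier ∧ γ.range ∩ frontier Q.carrier ⊆ {Q.pt 0, Q.pt 2}) :
    Summit.CriticalPhenomena.SAWScalingLimit.Theses.SAWLoopFugacityFlow.SimpleSubseqLimits := by
  intro D a b hab s ν hs hν hlim
  obtain ⟨Q, rfl⟩ := exists_chord_eq D
  obtain ⟨N, hN⟩ := eventually_atTop.1 (tendsto_nhdsWithin_iff.1 hs).2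
  have hs0 : Tendsto s atTop (𝓝 (0 : ℝ)) := (tendsto_nhdsWithin_iff.1 hs).1
  exact h Q a b hab ν hν (fun n => s (n + N)) (fun n => hN (n + N) (N.le_add_left n))
    (hs0.comp (tendsto_add_atTop_nat N)) (fun f => (hlim f).comp (tendsto_add_atTop_nat N))

/-- **S1 ⟺ `SimpleSubseqLimits`**: the registered stub of crux `RemovableLimit`
(stmt-CriticalPhenomena-4503; left-hand side = its registered text, verbatim) and the sibling crux
stmt-CriticalPhenomena-4982 of route `SAWLoopFugacityFlow` are one and the same statement (so S1
inherits the terminal verdict `open-problem` of stmt-4982, and conversely any proof of S1 closes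
stmt-4982). [folklore] -/
theorem simpleChordLimit_iff_simpleSubseqLimits :
    (∀ (Q : ConformalRectangle) (a b : ℝ → Site 2),
      SAW.IsEndpointApprox (Q.chord 0 2 (by decide)) a b →
      ∀ (P : Measure (CurveClass ℂ)), IsProbabilityMeasure P → ∀ (δs : ℕ → ℝ), (∀ n, 0 < δs n) →
      Tendsto δs atTop (𝓝 0) →
      (∀ f : BoundedContinuousFunction (CurveClass ℂ) ℝ,
        Tendsto (fun n => ∫ γ, f γ.curve ∂(SAW.law Q.carrier (δs n) (a (δs n)) (b (δs n)))) atTop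
          (𝓝 (∫ γ, f γ ∂P))) →
      ∀ᵐ γ ∂P, γ ∈ CurveClass.simple ∧ γ.source = Q.pt 0 ∧ γ.target = Q.pt 2 ∧
        γ.range ⊆ closure Q.carrier ∧ γ.range ∩ frontier Q.carrier ⊆ {Q.pt 0, Q.pt 2}) ↔
      Summit.CriticalPhenomena.SAWScalingLimit.Theses.SAWLoopFugacityFlow.SimpleSubseqLimits :=
  ⟨simpleSubseqLimits_of_stub, stub_of_simpleSubseqLimits⟩

/-- **The crux `RemovableLimit` implies the open sibling crux `SimpleSubseqLimits`** (drop the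
removability conjunct, then `simpleSubseqLimits_of_stub`): a formal pin recording that
stmt-CriticalPhenomena-4503 is at least as hard as stmt-CriticalPhenomena-4982. [folklore] -/
theorem simpleSubseqLimits_of_removableLimit
    (h : Summit.CriticalPhenomena.SAWScalingLimit.Theses.SAWWeldingIdentification.RemovableLimit) :
    Summit.CriticalPhenomena.SAWScalingLimit.Theses.SAWLoopFugacityFlow.SimpleSubseqLimits :=
  simpleSubseqLimits_of_stub fun Q a b hab P hP δs hpos hδ hlim => by
    filter_upwards [h Q a b hab P hP δs hpos hδ hlim] with γ hγ
    exact hγ.1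

end Summit.CriticalPhenomena.SAWScalingLimit.Theorems.RemovableLimit
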